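/-
Copyright (c) 2026 the pub-hodgecm-mathlib formalisation cell (harness21).  Prover seat hodgecm-mathlib-K2E5-p16 (g5): Track B «K2-LIT»,
hLiu418 = stmt-HodgeConjecture-24832, ROAD Φ organ (SD-2) (arch integrals of twisted Gaussians = `ξ` in the `g`-binder), file (7d): the
`t`-derivatives `(d∕dt)^n xiShift (g₀ + t•Ξ) h α β |_{t=0}` are HOLOMORPHIC IN `s` along `(α, β) = (α₀ + us, β₀ + vs)` (Cauchy); 2026-09-04.
-/
import Summits.HodgeConjecture.HodgeConjecture.Theorems.K2LiuHermTwoXiShiftParamGrowth        -- (7c): growth on the disc, Cauchy estimate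
import Mathlib.Analysis.Calculus.ParametricIntervalIntegral
import HarnessLib

/-!
# Crux `HLiu418`, ROAD Φ, organ (SD-2) — file (7d): `s ↦ iteratedDeriv n (t ↦ xiShift (g₀ + t•Ξ) h (α₀ + us) (β₀ + vs)) 0` is holomorphic

Cell `hodgecm-mathlib`, crux item hLiu418 = `stmt-HodgeConjecture-24832`, route of record `HCCMUnconditional`; squad K2, LEAD F0P6-plan (g13)
(M-157i′, deal (SD-2)), co-dealer K2E5-plan (g6) («(c) `iteratedDeriv d (t ↦ …) 0` by ONE-variable Cauchy — holomorphic in `s`, three-factor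
growth kept»), prover K2E5-p16 (g5).  THEOREMS ONLY; lane `--supports stmt-HodgeConjecture-24832 --as helper`.

WHAT.  With the disc `‖t‖ < r` and the domination certificate of ★ (7b) `exists_differentiableOn_xiShift_param`:
* `differentiableOn_xiShift_affine_of_dominated` — for a FIXED complex `g` whose `2g` is dominated by `g₀` on the cone (every `g = g₀ + zΞ`,
  `‖z‖ ≤ r`), `s ↦ xiShift g h (α₀ + us) (β₀ + vs)` is holomorphic on `{0 < re(β₀ + vs)}` (★ (7a) + the entire prefactor);
* `differentiableOn_iteratedDeriv_xiShift_param` — THE HEAD: for `h > 0`, `U` open with `0 < re(β₀ + vs)` on `U`, every `n : ℕ`,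
  `s ↦ iteratedDeriv n (fun t => xiShift (g₀ + t•Ξ) h (α₀ + us) (β₀ + vs)) 0` is complex-differentiable on `U`.
PROOF.  Cauchy's formula on `C(0, r∕2)` (★ Mathlib `DiffContOnCl.circleIntegral_one_div_sub_center_pow_smul`) writes the derivative as
`(n!∕2πi) ∮ z^{−n−1} xiShift (g₀ + zΞ) h (α(s)) (β(s)) dz`; the integrand is holomorphic in `s` for each `z` and bounded by the three-factor
bound of ★ (7c) UNIFORMLY in `z` and in `s` near `s₀`, hence Lipschitz in `s` (Cauchy estimate ★ `Complex.norm_deriv_le_of_forall_mem_sphere_norm_le`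
+ the mean value inequality), and ★ `intervalIntegral.hasDerivAt_integral_of_dominated_loc_of_lip` differentiates under `∮`.
With ★ (7c) `norm_iteratedDeriv_xiShift_param_le` this gives (SD-2): every `t`-derivative at `0` is holomorphic in `s` on `{re β > 0}` with
the three-factor growth in `h` — so `Σ_j c_j (d∕dt)^{d_j} ξ(½·1 + tΞ_j, h; α_j, β_j)|_{t=0}` (the `K_∞`-finite Whittaker functions of
(SD-1-ind)) feeds Φ6b-5's M-test for EVERY `K_∞`-type.
HONEST LABEL.  Count-neutral helper of the K2_Liu road; it pays no socket by itself: `HC_CM` is proved only modulo the 7 printed citations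
(2 remaining named inputs: hLiu418 = `stmt-HodgeConjecture-24832`, h413 = `stmt-HodgeConjecture-24833`) until rung 0 closes.
-/

set_option autoImplicit false
-- the mandated namespace repeats the single-problem summit's segment (`HodgeConjecture.HodgeConjecture`)
set_option linter.dupNamespace false

noncomputable section

open Complex MeasureTheory Set Filter Topology
open scoped ComplexOrder ComplexConjugate Real Interval

namespace Summit.HodgeConjecture.HodgeConjecture.Cruxes.HLiu418.K2LiuHermTwoXiShiftCauchyDerivatives

open Summit.HodgeConjecture.HodgeConjecture.Cruxes.HLiu418.K2LiuHermTwoGammaDefs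
open Summit.HodgeConjecture.HodgeConjecture.Cruxes.HLiu418.K2LiuHermTwoEtaDefs
open Summit.HodgeConjecture.HodgeConjecture.Cruxes.HLiu418.K2LiuHermTwoEtaConvergence
open Summit.HodgeConjecture.HodgeConjecture.Cruxes.HLiu418.K2LiuHermTwoEtaHolomorphy
open Summit.HodgeConjecture.HodgeConjecture.Cruxes.HLiu418.K2LiuHermTwoXiEtaIdentity
open Summit.HodgeConjecture.HodgeConjecture.Cruxes.HLiu418.K2LiuHermTwoEtaShiftDefs
open Summit.HodgeConjecture.HodgeConjecture.Cruxes.HLiu418.K2LiuHermTwoXiBetaShift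
open Summit.HodgeConjecture.HodgeConjecture.Cruxes.HLiu418.K2LiuHermTwoEtaShiftDominated
open Summit.HodgeConjecture.HodgeConjecture.Cruxes.HLiu418.K2LiuHermTwoXiShiftParamHolomorphy
open Summit.HodgeConjecture.HodgeConjecture.Cruxes.HLiu418.K2LiuHermTwoXiShiftParamGrowth

/-! ## `s`-holomorphy of `xiShift g h` for a fixed complex `g` with `2g` dominated by `g₀` -/

/-- For a FIXED complex `g` whose double `2g` is dominated by `g₀ = hermTwo d > 0` on the cone, `s ↦ xiShift g h (α₀ + us) (β₀ + vs)` is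
holomorphic on every `U ⊆ {0 < re(β₀ + vs)}`. -/
theorem differentiableOn_xiShift_affine_of_dominated {d : ℝ × ℂ × ℝ} (hd : 0 < d.1 ∧ normSq d.2.1 < d.1 * d.2.2) {g : Matrix (Fin 2) (Fin 2) ℂ}
    (hdom : ∀ c : ℝ × ℂ × ℝ, (0 < c.1 ∧ normSq c.2.1 < c.1 * c.2.2) →
      ‖cexp (-(hermTwo c * ((2 : ℂ) • g)).trace)‖ ≤ ‖cexp (-(hermTwo c * hermTwo d).trace)‖)
    {h : Matrix (Fin 2) (Fin 2) ℂ} (hh : h.PosDef) (α₀ β₀ u v : ℂ) {U : Set ℂ} (hU0 : ∀ s ∈ U, 0 < (β₀ + v * s).re) :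
    DifferentiableOn ℂ (fun s : ℂ => xiShift g h (α₀ + u * s) (β₀ + v * s)) U := by
  have hg₀ : (hermTwo d).PosDef := (posDef_hermTwo_iff d).mpr hd
  have hπh : ((Real.pi : ℂ) • h).PosDef := posDef_pi_smul hh
  have hdom' : ∀ c ∈ etaTwoSet ((Real.pi : ℂ) • h), ‖cexp (-(hermTwo c * ((2 : ℂ) • g)).trace)‖ ≤ ‖cexp (-(hermTwo c * hermTwo d).trace)‖ := by
    intro c hc
    obtain ⟨-, hcm⟩ := (mem_etaTwoSet_iff _ c).mp hc
    have hx : (hermTwo c).PosDef := by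
      have := hcm.add_posSemidef hπh.posSemidef
      rwa [sub_add_cancel] at this
    exact hdom c ((posDef_hermTwo_iff c).mp hx)
  have hη := differentiableOn_etaShift_affine_of_dominated_of_subset hg₀ hπh hdom' α₀ β₀ u v hU0
  have hα : Differentiable ℂ (fun s : ℂ => α₀ + u * s) := (differentiable_id.const_mul u).const_add α₀
  have hβ : Differentiable ℂ (fun s : ℂ => β₀ + v * s) := (differentiable_id.const_mul v).const_add β₀
  have hexp : Differentiable ℂ (fun s : ℂ => cexp ((Real.pi * I) * ((β₀ + v * s) - (α₀ + u * s)))) := ((hβ.sub hα).const_mul _).cexp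
  have hΓα : Differentiable ℂ (fun s : ℂ => (hermTwoGamma (α₀ + u * s))⁻¹) := differentiable_hermTwoGamma_inv.comp hα
  have hΓβ : Differentiable ℂ (fun s : ℂ => ((Real.pi : ℂ) * Complex.Gamma (β₀ + v * s) ^ 2)⁻¹) := differentiable_inv_pi_Gamma_sq.comp hβ
  simp only [xiShift_def]
  exact (((((differentiable_const _).mul hexp).mul hΓα).mul hΓβ).differentiableOn).mul hη

/-! ## The head: `s`-holomorphy of the `t`-derivatives at `0` -/

/-- **THE `t`-DERIVATIVES OF `xiShift (g₀ + t•Ξ) h` AT `t = 0` ARE HOLOMORPHIC IN `s`** (head of (SD-2)).  Let `g₀ = hermTwo d > 0`, `Ξ` a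
direction, `r > 0` with the domination certificate of ★ (7b) on `‖t‖ ≤ r` and the `t`-holomorphy on `ball 0 r`; then for `h > 0`, `U` open
with `0 < re(β₀ + vs)` on `U` and every `n`, `s ↦ iteratedDeriv n (fun t => xiShift (g₀ + t•Ξ) h (α₀ + us) (β₀ + vs)) 0` is
complex-differentiable on `U`. -/
theorem differentiableOn_iteratedDeriv_xiShift_param {d : ℝ × ℂ × ℝ} (hd : 0 < d.1 ∧ normSq d.2.1 < d.1 * d.2.2) (Ξ : Matrix (Fin 2) (Fin 2) ℂ)
    {r : ℝ} (hr : 0 < r)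
    (hcert : ∀ t : ℂ, ‖t‖ ≤ r → ∀ c : ℝ × ℂ × ℝ, (0 < c.1 ∧ normSq c.2.1 < c.1 * c.2.2) →
      ‖cexp (-(hermTwo c * (hermTwo ((2 : ℝ) • d) + t • ((2 : ℂ) • Ξ))).trace)‖ ≤ ‖cexp (-(hermTwo c * hermTwo ((1 / 2 : ℝ) • ((2 : ℝ) • d))).trace)‖)
    (hdiffT : ∀ {h : Matrix (Fin 2) (Fin 2) ℂ}, h.PosDef → ∀ (α : ℂ) {β : ℂ}, 0 < β.re →
      DifferentiableOn ℂ (fun t : ℂ => xiShift (hermTwo d + t • Ξ) h α β) (Metric.ball 0 r))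
    {h : Matrix (Fin 2) (Fin 2) ℂ} (hh : h.PosDef) (α₀ β₀ u v : ℂ) {U : Set ℂ} (hU : IsOpen U) (hU0 : ∀ s ∈ U, 0 < (β₀ + v * s).re)
    (n : ℕ) :
    DifferentiableOn ℂ (fun s : ℂ => iteratedDeriv n (fun t : ℂ => xiShift (hermTwo d + t • Ξ) h (α₀ + u * s) (β₀ + v * s)) 0) U := by
  set ρ : ℝ := r / 2 with hρ
  have hρ0 : 0 < ρ := by rw [hρ]; linarith
  have hρr : ρ < r := by rw [hρ]; linarith
  have hhalf : hermTwo ((1 / 2 : ℝ) • ((2 : ℝ) • d)) = hermTwo d := by rw [smul_smul]; norm_num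
  -- the integrand of the Cauchy formula, as a function of `(s, θ)`
  set Φ : ℂ → ℝ → ℂ := fun s θ => deriv (circleMap 0 ρ) θ •
    ((1 / (circleMap 0 ρ θ - 0) ^ (n + 1)) • xiShift (hermTwo d + circleMap 0 ρ θ • Ξ) h (α₀ + u * s) (β₀ + v * s)) with hΦ
  -- (1) Cauchy's formula on `U`
  have hCauchy : ∀ s ∈ U, iteratedDeriv n (fun t : ℂ => xiShift (hermTwo d + t • Ξ) h (α₀ + u * s) (β₀ + v * s)) 0 =
      (2 * π * I / n.factorial)⁻¹ • ∫ θ in (0 : ℝ)..2 * π, Φ s θ := by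
    intro s hs
    have hdiff := hdiffT hh (α₀ + u * s) (hU0 s hs)
    have hf : DiffContOnCl ℂ (fun t : ℂ => xiShift (hermTwo d + t • Ξ) h (α₀ + u * s) (β₀ + v * s)) (Metric.ball 0 ρ) := by
      refine ⟨hdiff.mono (Metric.ball_subset_ball hρr.le), ?_⟩
      rw [closure_ball (0 : ℂ) hρ0.ne']
      exact hdiff.continuousOn.mono (Metric.closedBall_subset_ball hρr)
    have hcf := hf.circleIntegral_one_div_sub_center_pow_smul hρ0 n
    have hc : (2 * π * I / n.factorial : ℂ) ≠ 0 := div_ne_zero two_pi_I_ne_zero (by exact_mod_cast n.factorial_ne_zero)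
    have hI : ∫ θ in (0 : ℝ)..2 * π, Φ s θ =
        ∮ z in C(0, ρ), (1 / (z - 0) ^ (n + 1)) • xiShift (hermTwo d + z • Ξ) h (α₀ + u * s) (β₀ + v * s) := rfl
    rw [hI, hcf, smul_smul, inv_mul_cancel₀ hc, one_smul]
  refine (DifferentiableOn.const_smul (c := (2 * π * I / n.factorial : ℂ)⁻¹) ?_).congr fun s hs => hCauchy s hs
  -- (2) holomorphy in `s` of the circle integral, at a point `s₀ ∈ U`
  intro s₀ hs₀
  obtain ⟨ε₀, hε₀, hballU⟩ := Metric.isOpen_iff.mp hU s₀ hs₀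
  set ε : ℝ := ε₀ / 3 with hε
  have hεpos : 0 < ε := by rw [hε]; positivity
  have hcbU : Metric.closedBall s₀ (2 * ε) ⊆ U := (Metric.closedBall_subset_ball (by rw [hε]; linarith)).trans hballU
  -- the uniform bound on `closedBall s₀ 2ε × {‖z‖ ≤ r}`
  have hKc : IsCompact (Metric.closedBall s₀ (2 * ε)) := isCompact_closedBall _ _
  have hKα : IsCompact ((fun s : ℂ => α₀ + u * s) '' Metric.closedBall s₀ (2 * ε)) := hKc.image (by fun_prop)
  have hLβ : IsCompact ((fun s : ℂ => β₀ + v * s) '' Metric.closedBall s₀ (2 * ε)) := hKc.image (by fun_prop)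
  have hL0 : ∀ β ∈ (fun s : ℂ => β₀ + v * s) '' Metric.closedBall s₀ (2 * ε), 0 < β.re := by
    rintro β ⟨s, hs, rfl⟩
    exact hU0 s (hcbU hs)
  obtain ⟨C, N, N', hC, hN, hN', hB⟩ := norm_xiShift_param_le₂ hd Ξ hr.le hcert hKα hLβ hL0
  set B : ℝ := C * Real.exp (-(Real.pi * ((h * hermTwo d).trace).re)) * (1 + ((h 0 0).re + (h 1 1).re)) ^ N *
    (1 + ((h 0 0).re * (h 1 1).re - normSq (h 0 1)) ^ (-N')) with hBdef
  have hBound : ∀ t : ℂ, ‖t‖ ≤ r → ∀ s ∈ Metric.closedBall s₀ (2 * ε), ‖xiShift (hermTwo d + t • Ξ) h (α₀ + u * s) (β₀ + v * s)‖ ≤ B :=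
    fun t ht s hs => hB t ht h hh (α₀ + u * s) ⟨s, hs, rfl⟩ (β₀ + v * s) ⟨s, hs, rfl⟩
  have hB0 : 0 ≤ B := le_trans (norm_nonneg _) (hBound 0 (by simpa using hr.le) s₀ (Metric.mem_closedBall_self (by positivity)))
  set M : ℝ := ρ * ((ρ ^ (n + 1))⁻¹ * B) with hMdef
  have hM0 : 0 ≤ M := by positivity
  -- the points of the circle lie in the closed disc of radius `r`
  have hzr : ∀ θ : ℝ, ‖circleMap 0 ρ θ‖ ≤ r := fun θ => by rw [norm_circleMap_zero, abs_of_pos hρ0]; exact hρr.le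
  have hzball : ∀ θ : ℝ, circleMap 0 ρ θ ∈ Metric.ball (0 : ℂ) r := fun θ => by
    rw [mem_ball_zero_iff, norm_circleMap_zero, abs_of_pos hρ0]; exact hρr
  -- (a) `Φ · θ` is holomorphic on `U` for every `θ`
  have hΦdiff : ∀ θ : ℝ, DifferentiableOn ℂ (fun s => Φ s θ) U := by
    intro θ
    have hdomz : ∀ c : ℝ × ℂ × ℝ, (0 < c.1 ∧ normSq c.2.1 < c.1 * c.2.2) →
        ‖cexp (-(hermTwo c * ((2 : ℂ) • (hermTwo d + circleMap 0 ρ θ • Ξ))).trace)‖ ≤ ‖cexp (-(hermTwo c * hermTwo d).trace)‖ := by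
      intro c hc
      have h1 := hcert (circleMap 0 ρ θ) (hzr θ) c hc
      rw [hhalf] at h1
      rw [two_smul_param]
      exact h1
    simp only [hΦ]
    exact ((differentiableOn_xiShift_affine_of_dominated hd hdomz hh α₀ β₀ u v hU0).const_smul
      (1 / (circleMap 0 ρ θ - 0) ^ (n + 1))).const_smul (deriv (circleMap 0 ρ) θ)
  -- (b) the bound `‖Φ s θ‖ ≤ M` on the closed ball
  have hΦle : ∀ θ : ℝ, ∀ s ∈ Metric.closedBall s₀ (2 * ε), ‖Φ s θ‖ ≤ M := by
    intro θ s hs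
    simp only [hΦ]
    rw [norm_smul, norm_smul, deriv_circleMap, norm_mul, Complex.norm_I, mul_one, norm_circleMap_zero, abs_of_pos hρ0, sub_zero,
      norm_div, norm_one, norm_pow, norm_circleMap_zero, abs_of_pos hρ0, one_div]
    exact mul_le_mul_of_nonneg_left (mul_le_mul_of_nonneg_left (hBound _ (hzr θ) s hs) (by positivity)) hρ0.le
  -- (c) `Φ · θ` is `M/ε`-Lipschitz on `ball s₀ ε`
  have hLip : ∀ θ : ℝ, LipschitzOnWith (Real.nnabs (M / ε)) (fun s => Φ s θ) (Metric.ball s₀ ε) := by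
    intro θ
    have hdU : ∀ s ∈ Metric.ball s₀ ε, DifferentiableAt ℂ (fun s => Φ s θ) s := fun s hs =>
      (hΦdiff θ).differentiableAt (hU.mem_nhds (hcbU (Metric.ball_subset_closedBall
        (Metric.ball_subset_ball (by linarith) hs))))
    refine Convex.lipschitzOnWith_of_nnnorm_deriv_le hdU (fun s hs => ?_) (convex_ball s₀ ε)
    have hsub : Metric.closedBall s ε ⊆ Metric.closedBall s₀ (2 * ε) := by
      intro z hz
      rw [Metric.mem_closedBall] at hz ⊢
      have := Metric.mem_ball.mp hs
      linarith [dist_triangle z s s₀]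
    have hf : DiffContOnCl ℂ (fun s => Φ s θ) (Metric.ball s ε) := by
      refine ⟨(hΦdiff θ).mono ((Metric.ball_subset_closedBall).trans (hsub.trans hcbU)), ?_⟩
      rw [closure_ball s hεpos.ne']
      exact (hΦdiff θ).continuousOn.mono (hsub.trans hcbU)
    have hder := Complex.norm_deriv_le_of_forall_mem_sphere_norm_le hεpos hf fun z hz => hΦle θ z (hsub (Metric.sphere_subset_closedBall hz))
    have hcoe : ((Real.nnabs (M / ε) : NNReal) : ℝ) = M / ε := by rw [Real.coe_nnabs, abs_of_nonneg (by positivity)]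
    rw [← NNReal.coe_le_coe, coe_nnnorm, hcoe]
    exact hder
  -- (d) measurability in `θ`: continuity
  have hΦcont : ∀ s ∈ U, Continuous (fun θ : ℝ => Φ s θ) := by
    intro s hs
    simp only [hΦ, deriv_circleMap]
    have hF : Continuous (fun θ : ℝ => xiShift (hermTwo d + circleMap 0 ρ θ • Ξ) h (α₀ + u * s) (β₀ + v * s)) :=
      (hdiffT hh (α₀ + u * s) (hU0 s hs)).continuousOn.comp_continuous (continuous_circleMap 0 ρ) hzball
    have ha : Continuous (fun θ : ℝ => circleMap 0 ρ θ * I) := (continuous_circleMap 0 ρ).mul continuous_const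
    have hb : Continuous (fun θ : ℝ => (1 : ℂ) / (circleMap 0 ρ θ - 0) ^ (n + 1)) :=
      continuous_const.div (((continuous_circleMap 0 ρ).sub continuous_const).pow _)
        fun θ => pow_ne_zero _ (sub_ne_zero.mpr (circleMap_ne_center hρ0.ne'))
    exact ha.smul (hb.smul hF)
  -- (e) the `s`-derivative at `s₀` is measurable in `θ` (limit of difference quotients along `s₀ + ε/(k+2)`)
  have hderiv : ∀ θ : ℝ, HasDerivAt (fun s => Φ s θ) (deriv (fun s => Φ s θ) s₀) s₀ := fun θ =>
    ((hΦdiff θ).differentiableAt (hU.mem_nhds hs₀)).hasDerivAt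
  have hF'meas : AEStronglyMeasurable (fun θ : ℝ => deriv (fun s => Φ s θ) s₀) (volume.restrict (Ι (0 : ℝ) (2 * π))) := by
    set τ : ℕ → ℂ := fun k => ((ε / ((k : ℝ) + 2) : ℝ) : ℂ) with hτ
    have hτpos : ∀ k : ℕ, 0 < ε / ((k : ℝ) + 2) := fun k => by positivity
    have hτU : ∀ k : ℕ, s₀ + τ k ∈ U := by
      intro k
      refine hcbU ?_
      rw [Metric.mem_closedBall, dist_eq_norm, add_sub_cancel_left, hτ, Complex.norm_real, Real.norm_of_nonneg (hτpos k).le]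
      have hk : (0 : ℝ) ≤ k := Nat.cast_nonneg k
      have : ε / ((k : ℝ) + 2) ≤ ε := div_le_self hεpos.le (by linarith)
      linarith
    have hτlim : Tendsto τ atTop (𝓝[≠] 0) := by
      refine tendsto_nhdsWithin_iff.mpr ⟨?_, Filter.Eventually.of_forall fun k => ?_⟩
      · have h1 : Tendsto (fun k : ℕ => ε / ((k : ℝ) + 2)) atTop (𝓝 0) := by
          have h0 := (tendsto_const_div_atTop_nhds_zero_nat ε).comp (tendsto_add_atTop_nat 2)
          refine h0.congr fun k => ?_
          simp only [Function.comp_apply, Nat.cast_add, Nat.cast_ofNat]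
        have h2 := (continuous_ofReal.tendsto 0).comp h1
        rwa [ofReal_zero] at h2
      · exact ofReal_ne_zero.mpr (hτpos k).ne'
    have hlim : ∀ θ : ℝ, Tendsto (fun k : ℕ => (τ k)⁻¹ • (Φ (s₀ + τ k) θ - Φ s₀ θ)) atTop (𝓝 (deriv (fun s => Φ s θ) s₀)) :=
      fun θ => (hasDerivAt_iff_tendsto_slope_zero.mp (hderiv θ)).comp hτlim
    refine aestronglyMeasurable_of_tendsto_ae atTop (fun k => ?_) (Filter.Eventually.of_forall hlim)
    exact (((hΦcont _ (hτU k)).sub (hΦcont s₀ hs₀)).const_smul ((τ k)⁻¹)).aestronglyMeasurable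
  -- (f) differentiate under the integral sign
  have hmain := intervalIntegral.hasDerivAt_integral_of_dominated_loc_of_lip (μ := volume) (a := 0) (b := 2 * π)
    (F := Φ) (F' := fun θ => deriv (fun s => Φ s θ) s₀) (x₀ := s₀) (s := Metric.ball s₀ ε) (bound := fun _ => M / ε)
    (Metric.ball_mem_nhds s₀ hεpos) ?_ ((hΦcont s₀ hs₀).intervalIntegrable _ _) hF'meas
    (ae_of_all _ fun θ _ => hLip θ) intervalIntegrable_const (ae_of_all _ fun θ _ => hderiv θ)
  · exact hmain.2.differentiableAt.differentiableWithinAt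
  · exact Filter.eventually_of_mem (hU.mem_nhds hs₀) fun s hs => (hΦcont s hs).aestronglyMeasurable

end Summit.HodgeConjecture.HodgeConjecture.Cruxes.HLiu418.K2LiuHermTwoXiShiftCauchyDerivatives

end
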